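import Summits.HodgeConjecture.HodgeConjecture.Theorems.Ring2HypothesesWeilComponentsLadder
import HarnessLib

/-!
# Ring 2 — hypotheses layer, part XI-A: the LOCAL GERM of algebraic fibres on the `(K = ℚ(√-d), 2n, δ)`-components — the weakest transport hypothesis per component, with an abstract anchor

HONEST FRAMING: research route conditional on HC_CM; not a corollary; Q11.4-sentence-2 already refuted in dim ≥ 3.

Cell `pub-hodge-ring2`, seat `pub-hodge-ring2-typer2`, gen 7. `HC_CM` is ALWAYS the binder
`(hCM : Theses.RankFourFaces.CMAbelianHodge)` (stmt-HodgeConjecture-3052), never an axiom, never cited as known.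
Nothing in this file proves a case of the Hodge conjecture: every row is an implication between NAMED typed inputs,
and the only unconditional lemmas are on-path lemmas (`_of_hodgeConjecture`), slices, and one equivalence that is pure
point-set bookkeeping over the tree's Baire / Charles–Schnell lemma
(`WeilTypeLadder.mem_algebraicClasses_of_isOpen_subset_algebraicityLocus`).

## What this part adds (gen 7 owed item (3) of the seat HANDOFF; RING2-MAP `## §hypotheses gen 7`)

Parts VII-A/B (`Ring2HypothesesWeilComponents[Ladder]`) index Weil's question by the component `(ℚ(√-d), 2n, δ = det H)`
and transport algebraicity from an ANCHOR fibre to the whole family by the GLOBAL δ-restricted Weil-confined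
variational Hodge statement `WeilVariationalHodgeComponent n d δ` (W-VHC(δ)). The transport seat's sharper input for
the UNINDEXED question (`Ring2Transport.LocalWeilVHCAtCMQuadratic`, gen 1) is LOCAL: at a CM-presented fibre on which
the class is algebraic, a Euclidean-open set of algebraic fibres — the OUTPUT SHAPE of the strict semiregularity /
pro-representability theorems (Bloch 1972; Buchweitz–Flenner 2003 Thm. 5.1/5.2) at a semiregular representative, NOT
the weak criterion of Markman's Question 11.4 sentence 2 (refuted in dim ≥ 3, `SemiregularityWeakCriterionAbelianCounterexample`).
This part types the δ-restricted local germ ONCE over an ABSTRACT anchor predicate and derives every row from one engine: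

* `LocalWeilVHCAtComponent n d δ anchor` (schema) — in the binders of W-VHC(δ): at every fibre `𝒳_{s₀}` with
  `anchor 𝒳_{s₀} (W|)` AND `W|_{𝒳_{s₀}}` algebraic, an open `U ∋ s₀` of algebraic fibres.
  Instances: `LocalWeilVHCAtCMComponent n d δ` (CM-presented fibres; the δ-slice of `LocalWeilVHCAtCMQuadratic`),
  `LocalWeilVHCComponent n d δ` (every algebraic fibre: "the algebraicity locus of `W` is open").
* ENGINE `weilClassesComponent_of_pointed_of_local`: anchor valid + pointed δ-families with that anchor + the local
  germ at that anchor ⟹ `WeilClassesComponent n d δ` (anchor ⟹ one algebraic fibre ⟹ open set ⟹ Baire + CDK ⟹ all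
  fibres ⟹ read back along the chart).
* ROWS: W1-loc (`HC_CM` + CM-pointed + local-at-CM), W1′-loc (`HC_CM`-FREE: divisor-generated CM-pointed + local at
  divisor-generated CM fibres, or at CM fibres), W1″-loc (anchored + local at algebraic fibres), W6-loc (T6(δ)).
* EXACTNESS of the localisation: `weilVariationalHodgeComponent_iff_local : W-VHC(δ) ↔ LocalWeilVHCComponent n d δ`
  — on these bases (smooth irreducible quasi-projective) the global δ-variational statement IS the openness of the
  algebraicity germ at algebraic fibres; and the local leaf is ANTITONE in the anchor (`LocalWeilVHCAtComponent.anti`),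
  so local-at-CM ⟸ local-at-algebraic ⟺ W-VHC(δ).
* Junction with the unindexed rows: `LocalWeilVHCAtCMQuadratic → LocalWeilVHCAtCMComponent n d δ` (forget `δ`), and
  `weilClassesByComponent_of_HC_CM_local` (all components from the transport seat's three unindexed hypotheses).

HONEST COLUMN. Content vs. print: the local germ at a CM fibre is known in print exactly where a semiregular (or
K-secant, Markman) representative is known — disc-1 fourfolds / sixfolds over `ℚ(√-1)`, `ℚ(√-3)` (Schoen, Koike,
Markman 2023/2025) — i.e. nowhere new; for `n ≥ 4` and for `(3, d, δ ≠ -1)` every local leaf below is OPEN, like its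
global parent. `HC_CM` is NOMINAL on W1-loc (W1′-loc removes it), exactly as on W1/W1′. The CM-POWER rows (part VIII
anchor `cmPowerAnchor n`, `HC_CM` DISCHARGED by Tate) are one-liners of the engine with `cmPowerAnchor_valid`; they are
not restated here to keep this part independent of part VIII's build.

## References

* [BuchweitzFlenner2003] R.-O. Buchweitz, H. Flenner, *A semiregularity map for modules and applications to
  deformations*, Compositio Math. 137 (2003), Thm. 5.1, Thm. 5.2. [Bloch1972Semiregularity] S. Bloch, Invent. Math. 17 (1972).
* [CharlesSchnell2014Notes] F. Charles, C. Schnell, *Notes on absolute Hodge classes*, Conj. 11.3.1, Cor. 11.3.6,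
  Prop. 11.3.11 (proof). [MumfordAV1970] §6 Lemma.
* [vanGeemen1994HodgeAV] B. van Geemen, LNM 1594, 5.2–5.5, Thm. 6.12. [Deligne1982HodgeCycles] LNM 900 §4–5.
* [Markman2025SecantWeil] E. Markman, arXiv:2502.03415 (UNREFEREED), Thm. 1.5.1, §2.4.
  [Markman2025SurveySecant] arXiv:2509.23403 (UNREFEREED), Question 11.4, §12.
-/

set_option linter.dupNamespace false

noncomputable section

open CategoryTheory
open Literature.AlgebraicGeometry Literature.AlgebraicGeometry.Motives
open Literature.AlgebraicGeometry.HodgeTheory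
open Literature.AlgebraicTopology.SingularHomology
open Literature.AlgebraicGeometry.VanGeemen1994
open Summit.HodgeConjecture.HodgeConjecture.WeilTypeLadder
open Summit.HodgeConjecture.HodgeConjecture.Theses
open Summit.HodgeConjecture.HodgeConjecture.Ring2Transport

namespace Summit.HodgeConjecture.HodgeConjecture.Ring2.Hypotheses

/-! ### §1 The δ-restricted local germ over an abstract anchor, and its two named instances -/

/-- **`LocalWeilVHCAtComponent n d δ anchor` — LOCAL δ-restricted Weil-confined variational Hodge AT ANCHOR FIBRES
(schema; Summit-side typed input, NOT a Literature fact).** In the binders of `WeilVariationalHodgeComponent n d δ`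
(smooth projective `(ℚ(√-d), 2n, δ)`-Weil family `f : 𝒳 ⟶ S`, `𝒳`, `S` quasi-projective, `S` smooth irreducible,
global `W` fibrewise rational of type `(n,n)`, charts `HasWeilChartsOfDisc n d δ f W`): for every complex point `s₀`
with `anchor 𝒳_{s₀} (W|_{𝒳_{s₀}})` and `W|_{𝒳_{s₀}}` ALGEBRAIC there is a Euclidean-open `U ∋ s₀` of `S(ℂ)` with
`W|_{𝒳_t}` algebraic for all `t ∈ U` — the output shape of STRICT semiregularity (Buchweitz–Flenner Thm. 5.1/5.2) at a
semiregular representative on the anchor fibre. Antitone in `anchor` (`LocalWeilVHCAtComponent.anti`).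
[cite: BuchweitzFlenner2003, Thm. 5.1 and Thm. 5.2] [cite: CharlesSchnell2014Notes, Conj. 11.3.1 and Prop. 11.3.11] -/
def LocalWeilVHCAtComponent (n d : ℕ) (δ : weilNormResidueGroup d)
    (anchor : (X : SchemeOver ℂ) → complexBetti X (2 * n) → Prop) : Prop :=
  ∀ ⦃𝒳 S : SchemeOver ℂ⦄ (f : 𝒳 ⟶ S), IsSmoothProjectiveFamily f (2 * n) →
    IsQuasiProjectiveOver 𝒳 → IsQuasiProjectiveOver S → IrreducibleSpace S.left →
    AlgebraicGeometry.Smooth S.hom →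
    ∀ (W : complexBetti 𝒳 (2 * n)),
      (∀ s : ComplexPoints S,
        IsRationalClass (complexBetti.map (fiberι f s) (2 * n) W) ∧
          IsOfHodgeType (2 * n) (fiberOver f s) (2 * n) n n (complexBetti.map (fiberι f s) (2 * n) W)) →
      HasWeilChartsOfDisc n d δ f W →
      ∀ s₀ : ComplexPoints S, anchor (fiberOver f s₀) (complexBetti.map (fiberι f s₀) (2 * n) W) →
        complexBetti.map (fiberι f s₀) (2 * n) W ∈ algebraicClasses (fiberOver f s₀) n →
        ∃ U : Set (ComplexPoints S), IsOpen U ∧ s₀ ∈ U ∧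
          ∀ t ∈ U, complexBetti.map (fiberι f t) (2 * n) W ∈ algebraicClasses (fiberOver f t) n

/-- **`LocalWeilVHCAtCMComponent n d δ` — the local germ AT CM-PRESENTED FIBRES of `(ℚ(√-d), 2n, δ)`-Weil families
(typed missing input; a CASE of the summit).** `LocalWeilVHCAtComponent` with the CM anchor `cmAnchor n`; the
δ-restricted form of `Ring2Transport.LocalWeilVHCAtCMQuadratic` (`localWeilVHCAtCMComponent_of_localWeilVHCAtCMQuadratic`).
WEAKER than W-VHC(δ) (`localWeilVHCAtCMComponent_of_weilVariationalHodgeComponent`). Known in print on NO component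
beyond those where the component target itself is known. ON-PATH: `localWeilVHCAtCMComponent_of_hodgeConjecture`.
[cite: BuchweitzFlenner2003, Thm. 5.1] [cite: Markman2025SurveySecant, Question 11.4 and §12 (preprint, unrefereed)]
[status: open] -/
@[conjecture] def LocalWeilVHCAtCMComponent (n d : ℕ) (δ : weilNormResidueGroup d) : Prop :=
  LocalWeilVHCAtComponent n d δ (cmAnchor n)

/-- **`LocalWeilVHCComponent n d δ` — the local germ AT EVERY ALGEBRAIC FIBRE ("the algebraicity locus of `W` is open")
on `(ℚ(√-d), 2n, δ)`-Weil families (typed missing input; a CASE of the summit).** `LocalWeilVHCAtComponent` with the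
algebraic anchor. EQUIVALENT to the global leaf W-VHC(δ) over these bases (`weilVariationalHodgeComponent_iff_local`).
[cite: CharlesSchnell2014Notes, Conj. 11.3.1 and Prop. 11.3.11] [status: open] -/
@[conjecture] def LocalWeilVHCComponent (n d : ℕ) (δ : weilNormResidueGroup d) : Prop :=
  LocalWeilVHCAtComponent n d δ (algebraicAnchor n)

/-! ### §2 Bookkeeping: antitonicity, the global leaf, on-path, slices -/

/-- The local germ is ANTITONE in the anchor: asking it at MORE fibres is a stronger hypothesis. [folklore] -/
theorem LocalWeilVHCAtComponent.anti {n d : ℕ} {δ : weilNormResidueGroup d}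
    {P Q : (X : SchemeOver ℂ) → complexBetti X (2 * n) → Prop} (hPQ : ∀ X x, P X x → Q X x)
    (hL : LocalWeilVHCAtComponent n d δ Q) : LocalWeilVHCAtComponent n d δ P :=
  fun _ _ f hf h𝒳 hS hirrS hsm W hW hch s₀ hanch hs₀ ↦
    hL f hf h𝒳 hS hirrS hsm W hW hch s₀ (hPQ _ _ hanch) hs₀

/-- The GLOBAL δ-leaf implies the local germ at any anchor (`U = S(ℂ)`). [cite: CharlesSchnell2014Notes, Conj. 11.3.1] -/
theorem localWeilVHCAtComponent_of_weilVariationalHodgeComponent {n d : ℕ} {δ : weilNormResidueGroup d}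
    (hV : WeilVariationalHodgeComponent n d δ) (anchor : (X : SchemeOver ℂ) → complexBetti X (2 * n) → Prop) :
    LocalWeilVHCAtComponent n d δ anchor :=
  fun _ _ f hf h𝒳 hS hirrS hsm W hW hch s₀ _ hs₀ ↦
    ⟨Set.univ, isOpen_univ, Set.mem_univ s₀, fun t _ ↦ hV f hf h𝒳 hS hirrS hsm W hW hch ⟨s₀, hs₀⟩ t⟩

/-- ON-PATH: the local germ at any anchor is a case of the summit (fibrewise, `U = S(ℂ)`).
[cite: CharlesSchnell2014Notes, Cor. 11.3.6] -/
theorem localWeilVHCAtComponent_of_hodgeConjecture (h : _root_.HodgeConjecture) (n d : ℕ)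
    (δ : weilNormResidueGroup d) (anchor : (X : SchemeOver ℂ) → complexBetti X (2 * n) → Prop) :
    LocalWeilVHCAtComponent n d δ anchor :=
  fun _ _ _ hf _ _ _ _ _ hW _ s₀ _ _ ↦
    ⟨Set.univ, isOpen_univ, Set.mem_univ s₀, fun t _ ↦ (h (hf.isSmoothProjective t)).2 n _ (hW t).1 (hW t).2⟩

/-- ON-PATH for the CM instance. [cite: CharlesSchnell2014Notes, Cor. 11.3.6] -/
theorem localWeilVHCAtCMComponent_of_hodgeConjecture (h : _root_.HodgeConjecture) (n d : ℕ)
    (δ : weilNormResidueGroup d) : LocalWeilVHCAtCMComponent n d δ :=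
  localWeilVHCAtComponent_of_hodgeConjecture h n d δ (cmAnchor n)

/-- ON-PATH for the algebraic instance. [cite: CharlesSchnell2014Notes, Cor. 11.3.6] -/
theorem localWeilVHCComponent_of_hodgeConjecture (h : _root_.HodgeConjecture) (n d : ℕ)
    (δ : weilNormResidueGroup d) : LocalWeilVHCComponent n d δ :=
  localWeilVHCAtComponent_of_hodgeConjecture h n d δ (algebraicAnchor n)

/-- The CM instance is WEAKER than W-VHC(δ). [cite: CharlesSchnell2014Notes, Conj. 11.3.1] -/
theorem localWeilVHCAtCMComponent_of_weilVariationalHodgeComponent {n d : ℕ} {δ : weilNormResidueGroup d}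
    (hV : WeilVariationalHodgeComponent n d δ) : LocalWeilVHCAtCMComponent n d δ :=
  localWeilVHCAtComponent_of_weilVariationalHodgeComponent hV (cmAnchor n)

/-- SLICE: the transport seat's unindexed local germ at CM fibres (`Ring2Transport.LocalWeilVHCAtCMQuadratic`, every
`n ≥ 2`, `d ≥ 1`) implies the δ-restricted one (forget the polarizations of the charts, `HasWeilChartsOfDisc.charts`).
[cite: vanGeemen1994HodgeAV, Lemma 5.2] -/
theorem localWeilVHCAtCMComponent_of_localWeilVHCAtCMQuadratic (hL : LocalWeilVHCAtCMQuadratic) {n d : ℕ}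
    (hn : 2 ≤ n) (hd : 0 < d) (δ : weilNormResidueGroup d) : LocalWeilVHCAtCMComponent n d δ :=
  fun _ _ f hf h𝒳 hS hirrS hsm W hW hch s₀ hanch hs₀ ↦
    hL n hn d hd f hf h𝒳 hS hirrS hsm W hW hch.charts s₀ hanch hs₀

/-- local-at-algebraic ⟹ local-at-CM (an anchored CM fibre is in particular an algebraic fibre: the germ is asked
only where `W|` is algebraic anyway). [folklore] -/
theorem localWeilVHCAtCMComponent_of_localWeilVHCComponent {n d : ℕ} {δ : weilNormResidueGroup d}
    (hL : LocalWeilVHCComponent n d δ) : LocalWeilVHCAtCMComponent n d δ :=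
  fun _ _ f hf h𝒳 hS hirrS hsm W hW hch s₀ _ hs₀ ↦ hL f hf h𝒳 hS hirrS hsm W hW hch s₀ hs₀ hs₀

/-- **EXACTNESS of the localisation: W-VHC(δ) ⟺ the local germ at algebraic fibres.** (→) `U = S(ℂ)`.
(←) one algebraic fibre `s₀` gives an open `U ∋ s₀` of algebraic fibres; a non-empty Euclidean-open subset of the
algebraicity locus of `W` over a smooth irreducible quasi-projective base is everything (Baire + Cattani–Deligne–Kaplan
/ Charles–Schnell Prop. 11.3.11, tree `WeilTypeLadder.mem_algebraicClasses_of_isOpen_subset_algebraicityLocus`).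
So the δ-variational leaf of parts VII-A/B carries exactly the content "the algebraicity germ is open".
[cite: CharlesSchnell2014Notes, Prop. 11.3.11 (proof)] [cite: MumfordAV1970, §6 Lemma] -/
theorem weilVariationalHodgeComponent_iff_local (n d : ℕ) (δ : weilNormResidueGroup d) :
    WeilVariationalHodgeComponent n d δ ↔ LocalWeilVHCComponent n d δ := by
  refine ⟨fun hV ↦ localWeilVHCAtComponent_of_weilVariationalHodgeComponent hV (algebraicAnchor n), fun hL ↦ ?_⟩
  rintro 𝒳 S f hf h𝒳 hS hirrS hsm W hW hch ⟨s₀, hs₀⟩ s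
  haveI := hirrS
  obtain ⟨U, hU, hs₀U, hUalg⟩ := hL f hf h𝒳 hS hirrS hsm W hW hch s₀ hs₀ hs₀
  exact mem_algebraicClasses_of_isOpen_subset_algebraicityLocus f h𝒳 hS hsm hf W hU ⟨s₀, hs₀U⟩ hUalg s

/-! ### §3 The anchor engine with the LOCAL germ, and the rows -/

/-- **ANCHOR ENGINE of the component, LOCAL form.** If the anchor predicate makes rational `(n,n)` classes algebraic
on the marked fibre, then pointed `(ℚ(√-d), 2n, δ)`-Weil families with that anchor and the local germ AT THAT ANCHOR
give the class target of the component: take the family through `c ≠ 0`; the anchor makes `W|_{𝒳_{s₀}}` algebraic;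
the germ gives an open `U ∋ s₀` of algebraic fibres; Baire + Charles–Schnell makes every fibre algebraic, in
particular `𝒳_{s₁} ≅ A.X`; read back along `ι`. Compare the GLOBAL engine `weilClassesComponent_of_pointed_of_variational`.
[cite: CharlesSchnell2014Notes, Prop. 11.3.11 (proof)] [cite: BuchweitzFlenner2003, Thm. 5.1]
[cite: Markman2025SecantWeil, Thm. 1.5.1 (strategy; preprint, unrefereed)] -/
theorem weilClassesComponent_of_pointed_of_local {n d : ℕ} {δ : weilNormResidueGroup d}
    {anchor : (X : SchemeOver ℂ) → complexBetti X (2 * n) → Prop}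
    (hvalid : ∀ (X : SchemeOver ℂ) (x : complexBetti X (2 * n)), anchor X x → IsRationalClass x →
      IsOfHodgeType (2 * n) X (2 * n) n n x → x ∈ algebraicClasses X n)
    (hP : PointedWeilFamiliesComponent n d δ anchor) (hL : LocalWeilVHCAtComponent n d δ anchor) :
    WeilClassesComponent n d δ := by
  intro A φ hAdim hX hφ e a haQ ha0 hδ c hcQ hcH hc
  by_cases hc0 : c = 0
  · rw [hc0]; exact Submodule.zero_mem _
  obtain ⟨𝒳, S, f, s₁, s₀, ι, W, hf, h𝒳, hS, hirrS, hsm, hW, hch, hread, hanch⟩ :=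
    hP A φ hAdim hX hφ e a haQ ha0 hδ c hcQ hcH hc hc0
  haveI := hirrS
  have hs₀ : complexBetti.map (fiberι f s₀) (2 * n) W ∈ algebraicClasses (fiberOver f s₀) n :=
    hvalid _ _ hanch (hW s₀).1 (hW s₀).2
  obtain ⟨U, hU, hs₀U, hUalg⟩ := hL f hf h𝒳 hS hirrS hsm W hW hch s₀ hanch hs₀
  have h1 : complexBetti.map (fiberι f s₁) (2 * n) W ∈ algebraicClasses (fiberOver f s₁) n :=
    mem_algebraicClasses_of_isOpen_subset_algebraicityLocus f h𝒳 hS hsm hf W hU ⟨s₀, hs₀U⟩ hUalg s₁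
  rw [← hread]
  exact (mem_algebraicClasses_map_iff_of_iso ι).2 h1

/-- **Row W1-loc — `HC_Weil_K_2n_disc_of_HC_CM`, LOCAL form: the class target of `(ℚ(√-d), 2n, δ)` from `HC_CM`,
CM-pointed δ-families and the local germ AT CM FIBRES.** CONDITIONAL on the three named hypotheses; `HC_CM` NOMINAL
(row W1′-loc). The precise "one CM point ⟹ the whole component" principle that survives the refutation of Question
11.4 sentence 2. [cite: Deligne1982HodgeCycles, proof of Thm. 4.8] [cite: BuchweitzFlenner2003, Thm. 5.1]
[cite: Markman2025SurveySecant, §2 and §12 (preprint, unrefereed)] -/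
theorem weilClassesComponent_of_HC_CM_local (hCM : Theses.RankFourFaces.CMAbelianHodge) {n d : ℕ}
    {δ : weilNormResidueGroup d} (hP : CMPointedWeilFamiliesComponent n d δ)
    (hL : LocalWeilVHCAtCMComponent n d δ) : WeilClassesComponent n d δ :=
  weilClassesComponent_of_pointed_of_local (cmAnchor_valid_of_HC_CM hCM n) hP hL

/-- **Row W1′-loc — the same WITHOUT `HC_CM`**: divisor-generated CM-pointed δ-families (met in print on every
component for imaginary quadratic `K`: the diagonal member) and the local germ at DIVISOR-GENERATED CM fibres (weaker
than at all CM fibres). [cite: vanGeemen1994HodgeAV, 5.5] [cite: BuchweitzFlenner2003, Thm. 5.1] -/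
theorem weilClassesComponent_of_divisorGeneratedCMPointed_local {n d : ℕ} {δ : weilNormResidueGroup d}
    (hP : DivisorGeneratedCMPointedWeilFamiliesComponent n d δ)
    (hL : LocalWeilVHCAtComponent n d δ (divisorGeneratedCMAnchor n)) : WeilClassesComponent n d δ :=
  weilClassesComponent_of_pointed_of_local (divisorGeneratedCMAnchor_valid n) hP hL

/-- Row W1′-loc with the germ asked at all CM fibres (`LocalWeilVHCAtCMComponent`, antitonicity). NO `HC_CM`.
[cite: vanGeemen1994HodgeAV, 5.5] -/
theorem weilClassesComponent_of_divisorGeneratedCMPointed_localCM {n d : ℕ} {δ : weilNormResidueGroup d}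
    (hP : DivisorGeneratedCMPointedWeilFamiliesComponent n d δ) (hL : LocalWeilVHCAtCMComponent n d δ) :
    WeilClassesComponent n d δ :=
  weilClassesComponent_of_divisorGeneratedCMPointed_local hP
    (hL.anti fun _ _ ⟨A₀, he₀, hA₀dim, hA₀cm, _⟩ ↦ ⟨A₀, he₀, hA₀dim, hA₀cm⟩)

/-- **Row W1″-loc — R∞anc(δ) ∧ (local germ at algebraic fibres) ⟹ W(δ)** (= W1″ through the exactness
`weilVariationalHodgeComponent_iff_local`). [cite: Markman2025SecantWeil, Thm. 1.5.1 (strategy; preprint, unrefereed)] -/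
theorem weilClassesComponent_of_anchored_of_local {n d : ℕ} {δ : weilNormResidueGroup d}
    (hA : AnchoredWeilFamiliesComponent n d δ) (hL : LocalWeilVHCComponent n d δ) : WeilClassesComponent n d δ :=
  weilClassesComponent_of_pointed_of_local (algebraicAnchor_valid n) hA hL

/-- JUNCTION with the unindexed rows: ALL components from the transport seat's three unindexed hypotheses
(`HC_CM`, `CMPointedWeilFamiliesQuadratic`, `LocalWeilVHCAtCMQuadratic`) — via R∞
(`Ring2Transport.HC_WeilClassesQuadratic_of_HC_CM_local`) and `weilClassesByComponent_of_weilClassesImaginaryQuadratic`.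
[cite: Weil1977HodgeRing] [cite: BuchweitzFlenner2003, Thm. 5.1] -/
theorem weilClassesByComponent_of_HC_CM_local (hCM : Theses.RankFourFaces.CMAbelianHodge)
    (hP : CMPointedWeilFamiliesQuadratic) (hL : LocalWeilVHCAtCMQuadratic) : WeilClassesByComponent :=
  weilClassesByComponent_of_weilClassesImaginaryQuadratic (HC_WeilClassesQuadratic_of_HC_CM_local hCM hP hL)

/-! ### §4 T6(δ) — the general member of the component from the LOCAL rows -/

/-- **Row W6-loc — `HC_<general member of (K, 2n, δ)>_of_HC_CM`, LOCAL form**: from `HC_CM`, CM-pointed δ-families,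
the local germ at CM fibres and van Geemen's Thm. 6.12 (typed). CONDITIONAL on all four; `HC_CM` nominal.
[cite: vanGeemen1994HodgeAV, Thm. 6.12] -/
theorem hodgeGeneralWeilTypeComponent_of_HC_CM_local (hCM : Theses.RankFourFaces.CMAbelianHodge)
    (h612 : VanGeemen1994_thm612) {n d : ℕ} {δ : weilNormResidueGroup d} (hn : 0 < n) (hd : 0 < d)
    (hP : CMPointedWeilFamiliesComponent n d δ) (hL : LocalWeilVHCAtCMComponent n d δ) :
    HodgeGeneralWeilTypeComponent n d δ :=
  hodgeGeneralWeilTypeComponent_of_weilClassesComponent h612 hn hd (weilClassesComponent_of_HC_CM_local hCM hP hL)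

/-- Row W6′-loc — T6(δ) WITHOUT `HC_CM`: divisor-generated CM-pointed δ-families + the local germ at CM fibres + 6.12.
[cite: vanGeemen1994HodgeAV, 5.5 and Thm. 6.12] -/
theorem hodgeGeneralWeilTypeComponent_of_divisorGeneratedCMPointed_localCM (h612 : VanGeemen1994_thm612)
    {n d : ℕ} {δ : weilNormResidueGroup d} (hn : 0 < n) (hd : 0 < d)
    (hP : DivisorGeneratedCMPointedWeilFamiliesComponent n d δ) (hL : LocalWeilVHCAtCMComponent n d δ) :
    HodgeGeneralWeilTypeComponent n d δ :=
  hodgeGeneralWeilTypeComponent_of_weilClassesComponent h612 hn hd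
    (weilClassesComponent_of_divisorGeneratedCMPointed_localCM hP hL)

end Summit.HodgeConjecture.HodgeConjecture.Ring2.Hypotheses

end
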